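import Literature.InformationTheory.Coding.TensorProductCodes
import HarnessLib

/-!
# Cell qa-qnc0 (rung F-Q1, crux α, line `tensor`): one-direction-exact robustness of a tensor pair

Elementary bookkeeping for the tensor-robustness line of crux `RingToElim` (planner seat
qa-qnc0-p2, ROUND-1 §9.25–9.27; lit seat LIT-MEMO-7 §1.3), over the Literature vocabulary
`Literature/InformationTheory/Coding/TensorProductCodes.lean` (`TensorCode.tensorCode`,
`rowDefect`, `colDefect`, `tensorDefect`, `IsRobust`):

* `IsColExactRobust C₁ C₂ K` — robustness of the row/column test asked only of words whose
  columns are EXACTLY codewords of `C₁` (the shape of the line's stub `TR⁺`: "`X` with every column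
  in `C₁⁺`, `dist(X, C₁⁺ ⊗ C₂⁺) ≤ K · Σ_u dist(row_u X, C₂⁺)`"), and its additive-slack variant
  `IsColExactRobustUpTo C₁ C₂ K ε` (what the §9.27 coset theorem actually consumes);
* `isColExactRobust_of_isRobust`, `isRobust_of_isColExactRobust` — the one-direction-exact form
  is EQUIVALENT to ordinary robustness up to `K ↦ K + 1` (decode each column to its nearest
  `C₁`-codeword: the cost is the column defect, and the row defect grows by at most that cost).
  Consequence for the line: one-direction exactness buys nothing by itself — the printed
  non-robust pairs are already of this form (Valiant 2005 = Coppersmith–Rudra ECCC TR05-104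
  Thm 1: "every row of `v` is a codeword in `C₁`"; Goldreich–Meir 2012 §4: `δ_row(M) = 0`).

WHAT THIS IS NOT: no robustness theorem for any code family; nothing on `RingToElim` itself.
-/

noncomputable section

namespace Summit.QuantumAdvantage.AdviceFreeQNC0

open Matrix Finset
open Literature.InformationTheory.Coding Literature.InformationTheory.Coding.TensorCode

variable {F : Type*} [Field F] [DecidableEq F]
variable {ι : Type*} [Fintype ι]
variable {m n : Type*} [Fintype m] [Fintype n]

namespace TensorRobustness

/-- Triangle inequality for the distance to a code. -/
private theorem distTo_le_hammingDist_add (C : Submodule F (ι → F)) (v w : ι → F) :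
    distTo C v ≤ hammingDist v w + distTo C w := by
  obtain ⟨c, hc, hcw⟩ := exists_hammingDist_eq_distTo C w
  rw [← hcw]
  exact (distTo_le hc).trans (hammingDist_triangle v w c)

/-- `weight (M - N) = weight (N - M)`. -/
private theorem weight_sub_comm (M N : Matrix m n F) : weight (M - N) = weight (N - M) := by
  rw [weight_sub, weight_sub]
  exact Finset.sum_congr rfl fun i _ => hammingDist_comm _ _

/-- Triangle inequality for matrix weights. -/
private theorem weight_sub_le (M N P : Matrix m n F) :
    weight (M - P) ≤ weight (M - N) + weight (N - P) := by
  rw [weight_sub, weight_sub, weight_sub, ← Finset.sum_add_distrib]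
  exact Finset.sum_le_sum fun i _ => hammingDist_triangle (M i) (N i) (P i)

/-- The weight of a matrix as the sum of the Hamming weights of its columns. -/
private theorem weight_eq_sum_cols (M : Matrix m n F) : weight M = ∑ j, hammingNorm (Mᵀ j) := by
  unfold weight hammingNorm
  simp_rw [Finset.card_eq_sum_ones]
  rw [Finset.sum_comm' (t' := Finset.univ) (s' := fun j => Finset.univ.filter fun i => M i j ≠ 0)]
  · simp
  · intro i j
    simp

/-- `tensorDefect` is `1`-Lipschitz in the word. -/
private theorem tensorDefect_le_weight_add (C₁ : Submodule F (m → F)) (C₂ : Submodule F (n → F))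
    (M M' : Matrix m n F) :
    tensorDefect C₁ C₂ M ≤ weight (M - M') + tensorDefect C₁ C₂ M' := by
  obtain ⟨N, hN, hw⟩ := exists_weight_eq_tensorDefect C₁ C₂ M'
  rw [← hw]
  exact (tensorDefect_le hN).trans (weight_sub_le M M' N)

/-- The row defect is `1`-Lipschitz in the word. -/
private theorem rowDefect_le_weight_add (C₂ : Submodule F (n → F)) (M M' : Matrix m n F) :
    rowDefect C₂ M ≤ weight (M - M') + rowDefect C₂ M' := by
  unfold rowDefect
  rw [weight_sub, ← Finset.sum_add_distrib]
  exact Finset.sum_le_sum fun i _ => distTo_le_hammingDist_add C₂ (M i) (M' i)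

/-- Column-wise decoding: every word is within its column defect of a word with all columns in
`C₁`. -/
private theorem exists_mem_colCode_weight_eq (C₁ : Submodule F (m → F)) (M : Matrix m n F) :
    ∃ M' ∈ colCode n C₁, weight (M - M') = colDefect C₁ M := by
  choose c hc hdist using fun j => exists_hammingDist_eq_distTo C₁ (Mᵀ j)
  refine ⟨Matrix.of fun i j => c j i, mem_colCode_iff.mpr fun j => ?_, ?_⟩
  · have : (Matrix.of fun i j => c j i)ᵀ j = c j := funext fun i => rfl
    rw [this]; exact hc j
  · rw [weight_eq_sum_cols]
    refine Finset.sum_congr rfl fun j _ => ?_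
    rw [← hdist j, hammingDist_comm, hammingDist_eq_hammingNorm, neg_add_eq_sub]
    rfl

/-- **One-direction-exact robustness** of the pair `(C₁, C₂)` with constant `K`: every word whose
columns are EXACTLY codewords of `C₁` is within `K ×` (its row defect) of the tensor code `C₁ ⊗ C₂`
(count form). This is the shape of stub `TR⁺` of the tensor line (p2 ROUND-1 §9.27) and the form
in which the printed non-robust pairs are exhibited (CR05 Thm 1, GM12 §4). -/
def IsColExactRobust (C₁ : Submodule F (m → F)) (C₂ : Submodule F (n → F)) (K : ℝ) : Prop :=
  ∀ M ∈ colCode n C₁, (tensorDefect C₁ C₂ M : ℝ) ≤ K * rowDefect C₂ M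

/-- **Additive-slack variant** (what the §9.27 coset theorem consumes, LIT-MEMO-7 §1.3(c)): every
word with columns exactly in `C₁` is within `K ×` (row defect) `+ ε·|m|·|n|` of `C₁ ⊗ C₂`. -/
def IsColExactRobustUpTo (C₁ : Submodule F (m → F)) (C₂ : Submodule F (n → F)) (K ε : ℝ) :
    Prop :=
  ∀ M ∈ colCode n C₁,
    (tensorDefect C₁ C₂ M : ℝ) ≤ K * rowDefect C₂ M + ε * (Fintype.card m * Fintype.card n)

/-- Slack `0` is the exact notion. -/
theorem isColExactRobustUpTo_zero_iff {C₁ : Submodule F (m → F)} {C₂ : Submodule F (n → F)}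
    {K : ℝ} : IsColExactRobustUpTo C₁ C₂ K 0 ↔ IsColExactRobust C₁ C₂ K := by
  simp [IsColExactRobustUpTo, IsColExactRobust]

/-- Slack is monotone: a larger `ε` is a weaker requirement. -/
theorem IsColExactRobustUpTo.mono {C₁ : Submodule F (m → F)} {C₂ : Submodule F (n → F)}
    {K ε ε' : ℝ} (h : IsColExactRobustUpTo C₁ C₂ K ε) (hε : ε ≤ ε') :
    IsColExactRobustUpTo C₁ C₂ K ε' := by
  intro M hM
  have := h M hM
  have hmn : (0 : ℝ) ≤ Fintype.card m * Fintype.card n := by positivity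
  nlinarith [mul_le_mul_of_nonneg_right hε hmn]

/-- Full robustness implies one-direction-exact robustness with the same constant. -/
theorem isColExactRobust_of_isRobust {C₁ : Submodule F (m → F)} {C₂ : Submodule F (n → F)}
    {K : ℝ} (h : IsRobust C₁ C₂ K) : IsColExactRobust C₁ C₂ K := by
  intro M hM
  have := h M
  rwa [colDefect_eq_zero_of_mem hM, Nat.cast_zero, add_zero] at this

/-- **One-direction-exact robustness with constant `K ≥ 0` implies full robustness with constant
`K + 1`.** Decode every column of `M` to its nearest `C₁`-codeword, obtaining `M'` with columns in
`C₁` at weight-distance `colDefect M`; the row defect of `M'` exceeds that of `M` by at most the same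
amount; apply the hypothesis to `M'` and the triangle inequality for `tensorDefect`. -/
theorem isRobust_of_isColExactRobust {C₁ : Submodule F (m → F)} {C₂ : Submodule F (n → F)}
    {K : ℝ} (hK : 0 ≤ K) (h : IsColExactRobust C₁ C₂ K) : IsRobust C₁ C₂ (K + 1) := by
  intro M
  obtain ⟨M', hM', hw⟩ := exists_mem_colCode_weight_eq C₁ M
  have h1 : (tensorDefect C₁ C₂ M : ℝ) ≤ weight (M - M') + tensorDefect C₁ C₂ M' := by
    exact_mod_cast tensorDefect_le_weight_add C₁ C₂ M M'
  have h2 : (rowDefect C₂ M' : ℝ) ≤ weight (M' - M) + rowDefect C₂ M := by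
    exact_mod_cast rowDefect_le_weight_add C₂ M' M
  have h3 := h M' hM'
  rw [weight_sub_comm, hw] at h2
  rw [hw] at h1
  have h4 : (0 : ℝ) ≤ rowDefect C₂ M := Nat.cast_nonneg _
  have h5 : (0 : ℝ) ≤ colDefect C₁ M := Nat.cast_nonneg _
  nlinarith [mul_le_mul_of_nonneg_left h2 hK]

/-- The two notions define the same class of robustly testable pairs (constants within `+1`). -/
theorem exists_isRobust_iff_exists_isColExactRobust {C₁ : Submodule F (m → F)}
    {C₂ : Submodule F (n → F)} :
    (∃ K : ℝ, 0 ≤ K ∧ IsRobust C₁ C₂ K) ↔ ∃ K : ℝ, 0 ≤ K ∧ IsColExactRobust C₁ C₂ K := by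
  constructor
  · rintro ⟨K, hK, h⟩
    exact ⟨K, hK, isColExactRobust_of_isRobust h⟩
  · rintro ⟨K, hK, h⟩
    exact ⟨K + 1, by linarith, isRobust_of_isColExactRobust hK h⟩

end TensorRobustness

end Summit.QuantumAdvantage.AdviceFreeQNC0
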